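import Mathlib
import HarnessLib
import Summits.RiemannHypothesis.RiemannHypothesis.Theorems.IntegerScrewSmoothSectorDefs

/-!
# Route `ScrewLemmaKCoprofile` — the objects the route posits: the LATTICE CO-PROFILE and its
# Müntz datum

For a generator `g : ℝ → ℝ` (admissible in the sense of
`Summit.RiemannHypothesis.RiemannHypothesis.Theorems.IntegerScrew.SmoothSectorAdmissible`) the
route's items K1/K2 (`CoprofileIsometry`, `CoprofileMoments`) and the bridge `CoprofileParseval`
speak about the LATTICE CO-PROFILE

  `Φ_g(t) = Σ_{n=1}^{⌊1/t⌋} g′(n t)/n`,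

typed inline there as `∑ n ∈ Finset.Icc 1 ⌊1 / t⌋₊, deriv g (n * t) / n`.  This file names it
(`latticeCoprofile`, definitionally the inline expression) together with the two auxiliary objects
of the Müntz computation (Titchmarsh 1986, §2.11, absolutely convergent case; tree
`Literature.NumberTheory.LFunctions.mellin_tsum_comp_mul_nat`):

* `coprofileDatum g = 1_{(0,1]} · g′(u)/u` (complex-valued), so that
* `coprofileDatumSum g t = Σ_{n ≥ 1} coprofileDatum g (n t) = Φ_g(t)/t` for `t > 0`,

whence `𝓜Φ_g(s − 1) = 𝓜(coprofileDatumSum g)(s) = ζ(s)·∫₀¹ g′(u)u^{s−2} du` for `Re s > 1`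
(proved in the companion proof files, not here).  Definitions only, plus the elementary vanishing
and membership lemmas.  RH-free; nothing here bears on the truth of RH.
-/

noncomputable section

set_option linter.dupNamespace false

namespace Summit.RiemannHypothesis.RiemannHypothesis.Theorems.ScrewLemmaKCoprofile

open MeasureTheory Set

/-- The LATTICE CO-PROFILE `Φ_g(t) = Σ_{n=1}^{⌊1/t⌋} g′(n t)/n` of a generator `g` (for `t > 1`
and for `t ≤ 0` the sum is empty).  Definitionally the expression typed inline in the route items
`CoprofileMoments` / `CoprofileIsometry` / `CoprofileParseval`. [folklore] -/
def latticeCoprofile (g : ℝ → ℝ) (t : ℝ) : ℝ :=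
  ∑ n ∈ Finset.Icc 1 ⌊1 / t⌋₊, deriv g (n * t) / n

/-- The MÜNTZ DATUM of the co-profile: `F(u) = g′(u)/u` on `(0,1]`, `0` elsewhere
(complex-valued, to feed Mathlib's `mellin`). [folklore] -/
def coprofileDatum (g : ℝ → ℝ) : ℝ → ℂ :=
  (Set.Ioc (0:ℝ) 1).indicator fun u => (((deriv g u) / u : ℝ) : ℂ)

/-- The lattice sum `Σ_{n ≥ 1} F(n t)` of the Müntz datum (it equals `Φ_g(t)/t` for `t > 0`:
the sum is finite). [folklore] -/
def coprofileDatumSum (g : ℝ → ℝ) (t : ℝ) : ℂ :=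
  ∑' n : ℕ, coprofileDatum g (((n + 1 : ℕ) : ℝ) * t)

/-- The co-profile is literally the inline expression of the route items. [folklore] -/
theorem latticeCoprofile_def (g : ℝ → ℝ) :
    latticeCoprofile g = fun t => ∑ n ∈ Finset.Icc 1 ⌊1 / t⌋₊, deriv g (n * t) / n := rfl

/-- `Φ_g(t) = 0` for `t > 1` (empty sum). [folklore] -/
theorem latticeCoprofile_eq_zero_of_one_lt {g : ℝ → ℝ} {t : ℝ} (ht : 1 < t) :
    latticeCoprofile g t = 0 := by
  have h : ⌊1 / t⌋₊ = 0 := Nat.floor_eq_zero.mpr (by rw [div_lt_one (by linarith)]; exact ht)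
  unfold latticeCoprofile
  rw [h]
  simp

/-- `Φ_g(t) = 0` for `t ≤ 0` (empty sum, `⌊1/t⌋₊ = 0`). [folklore] -/
theorem latticeCoprofile_eq_zero_of_nonpos {g : ℝ → ℝ} {t : ℝ} (ht : t ≤ 0) :
    latticeCoprofile g t = 0 := by
  have h : ⌊1 / t⌋₊ = 0 := Nat.floor_eq_zero.mpr (by
    have : 1 / t ≤ 0 := one_div_nonpos.mpr ht
    linarith)
  unfold latticeCoprofile
  rw [h]
  simp

/-- The Müntz datum vanishes beyond `1`. [folklore] -/
theorem coprofileDatum_eq_zero_of_one_lt {g : ℝ → ℝ} {u : ℝ} (hu : 1 < u) :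
    coprofileDatum g u = 0 := by
  have : u ∉ Set.Ioc (0:ℝ) 1 := fun h => absurd h.2 (not_le.mpr hu)
  simp [coprofileDatum, this]

/-- The Müntz datum on `(0,1]`. [folklore] -/
theorem coprofileDatum_of_mem {g : ℝ → ℝ} {u : ℝ} (hu : u ∈ Set.Ioc (0:ℝ) 1) :
    coprofileDatum g u = (((deriv g u) / u : ℝ) : ℂ) := by
  simp [coprofileDatum, Set.indicator_of_mem hu]

/-- The Müntz datum is measurable (`deriv g` is measurable for every `g`). [folklore] -/
theorem measurable_coprofileDatum (g : ℝ → ℝ) : Measurable (coprofileDatum g) := by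
  unfold coprofileDatum
  refine Measurable.indicator ?_ measurableSet_Ioc
  exact Complex.measurable_ofReal.comp ((measurable_deriv g).div measurable_id)

/-- `‖F(u)‖ = |g′(u)|/u` on `(0,1)`. [folklore] -/
theorem norm_coprofileDatum {g : ℝ → ℝ} {u : ℝ} (hu : u ∈ Set.Ioo (0:ℝ) 1) :
    ‖coprofileDatum g u‖ = |deriv g u| / u := by
  rw [coprofileDatum_of_mem (Set.Ioo_subset_Ioc_self hu), Complex.norm_real, Real.norm_eq_abs,
    abs_div, abs_of_pos hu.1]

end Summit.RiemannHypothesis.RiemannHypothesis.Theorems.ScrewLemmaKCoprofile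

end
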